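import Summits.HodgeConjecture.CorCM.IrreducibleOddWeightsCommutantDomination
import Summits.HodgeConjecture.CorCM.IrreducibleOddWeightsRestriction
import Mathlib.RingTheory.Finiteness.Lattice
import HarnessLib

/-!
# Sub-family domination, I: `rank Σ = rank Σ_ι` IFF every `MC_i` lies in `Σ_j MC_{ι j}`; the EXACT two-block defect
# `rank Σ|_p + rank Σ|_q = rank Σ|_{p ∪ q} + 1 + dim(MC_p ∩ MC_q)`

COR-CM (cell `pub-hodgecm2`, binder seat `b16` gen 74, count-neutral claim SUB-FAMILY DOMINATION AND HODGE
EQUIVALENCE, file S1 — abstract `G`-set level and type ranks; theorems only, no definition, no named fact, no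
`sorry`).  NEW as stated, hence under `Summits/`.  HONEST FRAMING: finite-dimensional linear algebra about the
Kubota–Dodson rank of a family of CM types and of its sub-families, read on the Mumford–Tate groups of products of
abelian varieties with complex multiplication: `rank Σ − 1 = dim Hg(∏_i A_i)`, `rank Σ_ι − 1 = dim Hg(∏_j A_{ι j})`
for a reindexing `ι : J → I` (a sub-product, possibly repeating factors; Deligne's Ex. 3.7).  Nothing is claimed
about the algebraicity of Hodge classes; `HC_CM` is neither used nor asserted.

CURRENCY (gen 64 R1 `…RightIdeals`): the MATRIX-COEFFICIENT SPACES `MC_i = span{g ↦ u_i(g·x) : x ∈ E_i} ≤ ℚ^G`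
(`= X^*(MT(A_i))_ℚ` on the generating Galois orbit), `rank Σ − 1 = dim ⨆_i MC_i`; for a set of slots `p` write
`MC_p = ⨆_{p i} MC_i` (`= X^*(MT(∏_{p} A_i))_ℚ`).  Gen 56 F1 `…Restriction` treats the reindexed family
`Σ_ι = sigmaType (Φ ∘ ι)` at the level of the translate modules `U(Σ)` (the restriction `U(Σ) ↠ U(Σ_ι)`,
`rank Σ_ι ≤ rank Σ`, equality iff the type vectors are EQUIVARIANTLY GENERATED by the kept ones) — imported, not
restated.  THIS FILE is the column-space side: containments and Grassmann identities among the `MC`'s, which give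
EXACT counts.

* §1 REINDEXING: `iSup_span_coeff_reindex_le` (`MC_{range ι} ≤ MC_I`), the EXCESS IDENTITY
  **`typeRank_sigmaType_reindex_add_finrank_iSup_eq`: `rank Σ_ι + dim ⨆_i MC_i = rank Σ + dim ⨆_j MC_{ι j}`**
  (`dim Hg(∏_I A_i) − dim Hg(∏_J A_{ι j}) = dim MC_I − dim MC_{range ι}`), and SUB-FAMILY DOMINATION
  **`typeRank_sigmaType_eq_reindex_iff_forall_span_coeff_le`: `rank Σ = rank Σ_ι ⟺ ∀ i, MC_i ≤ ⨆_j MC_{ι j}`** —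
  `MT(∏_I A_i) → MT(∏_J A_{ι j})` is an isogeny iff every `X^*(MT(A_i))_ℚ` lies in `X^*(MT(∏_J A_{ι j}))_ℚ`: every
  `A_i` is HODGE-DOMINATED by the sub-product (file K3 is `J = {i₀}`); `…_iff_iSup_span_coeff_eq`; reindexing
  along a surjection changes nothing (`typeRank_sigmaType_reindex_eq_of_surjective`); nested sub-families
  (`typeRank_sigmaType_eq_reindex_comp_iff`).
* §2 TWO BLOCKS: **`typeRank_sigmaType_add_typeRank_sigmaType_eq_of_union`: `rank Σ|_p + rank Σ|_q =
  rank Σ|_{p ∨ q} + 1 + dim(MC_p ∩ MC_q)`** — `dim Hg(∏_p A) + dim Hg(∏_q A) − dim Hg(∏_{p∪q} A)` is EXACTLY the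
  dimension of the space of matrix coefficients COMMON to the two sub-products (gen 64 R1's pair defect is `p, q`
  singletons; gen 56 F7's submodularity is the inequality `MC_{p∧q} ≤ MC_p ∩ MC_q`); additivity of two blocks iff
  `MC_p ∩ MC_q = 0`.
* §3 ONE MORE SLOT: **`typeRank_sigmaType_add_one_add_finrank_inf_eq_of_insert`: `rank Σ|_{p ∪ {i₀}} + 1 +
  dim(MC_p ∩ MC_{i₀}) = rank Σ|_p + rank Φ_{i₀}`** and **`typeRank_sigmaType_eq_iff_span_coeff_le_of_insert`:
  `rank Σ|_{p ∪ {i₀}} = rank Σ|_p ⟺ MC_{i₀} ≤ MC_p`** (`A_{i₀}` is Hodge-dominated by `∏_p A_i`; gen 56 F7 §2 is the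
  equivariant-generation form); whole family versus all-but-one (`…_of_erase`).

## References

* [Deligne1982HodgeCycles] P. Deligne, *Hodge cycles on abelian varieties*, LNM 900 (1982), I.3.4, I.5 (p. 53),
  I Ex. 3.7 (c).
* [Gordon1999HodgeAVSurvey] B. B. Gordon, *A survey of the Hodge conjecture for abelian varieties*, §3 Theorem (Imai,
  Murty) with proof, 7.5–7.7, 9.1.
* [Ribet1980] K. A. Ribet, *Division fields of abelian varieties with complex multiplication*, Mém. SMF 2 (1980),
  §3 (3.3).
-/

set_option autoImplicit false

noncomputable section

open scoped BigOperators Classical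

universe u u' u'' v w

namespace Summit.HodgeConjecture.CorCM.IrrOdd

open Literature.NumberTheory.ComplexMultiplication

variable {G : Type w} [Group G] {I : Type u} {E : I → Type v} [∀ i, MulAction G (E i)] [∀ i, Fintype (E i)]
  [Fintype I] {J : Type u'} [Fintype J] {J' : Type u''} [Fintype J']

/-! ### §1 Reindexing in the matrix-coefficient currency -/

omit [∀ i, Fintype (E i)] [Fintype I] [Fintype J] in
/-- `MC_{range ι} ≤ MC_I`: the matrix-coefficient space of a reindexed family lies in that of the family
(`X^*(MT(∏_J A_{ι j}))_ℚ ⊆ X^*(MT(∏_I A_i))_ℚ`). [cite: Deligne1982HodgeCycles, I.5 (p. 53)] -/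
theorem iSup_span_coeff_reindex_le (Φ : ∀ i, Set (E i)) (ι : J → I) :
    (⨆ j, Submodule.span ℚ (Set.range fun x : E (ι j) => fun g : G => antiVec (Φ (ι j)) g x)) ≤
      ⨆ i, Submodule.span ℚ (Set.range fun x : E i => fun g : G => antiVec (Φ i) g x) :=
  iSup_le fun j => le_iSup (fun i => Submodule.span ℚ (Set.range fun x : E i => fun g : G => antiVec (Φ i) g x)) (ι j)

/-- **THE REINDEXING EXCESS: `rank Σ_ι + dim ⨆_i MC_i = rank Σ + dim ⨆_j MC_{ι j}`**, i.e.
`dim Hg(∏_I A_i) − dim Hg(∏_J A_{ι j}) = dim MC_I − dim MC_{range ι}` (both ranks are `dim` of the column space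
`+ 1`, gen 64 R1). [cite: Deligne1982HodgeCycles, I.5 (p. 53) and I Ex. 3.7 (c)] [cite: Ribet1980, §3 (3.3)] -/
theorem typeRank_sigmaType_reindex_add_finrank_iSup_eq {ρ : G} {Φ : ∀ i, Set (E i)}
    (h : ∀ i, IsCMTypeWith ρ (Φ i)) (ι : J → I) [Nonempty (Σ j, E (ι j))] :
    typeRank G (sigmaType fun j => Φ (ι j)) +
        Module.finrank ℚ ↥(⨆ i, Submodule.span ℚ (Set.range fun x : E i => fun g : G => antiVec (Φ i) g x)) =
      typeRank G (sigmaType Φ) +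
        Module.finrank ℚ
          ↥(⨆ j, Submodule.span ℚ (Set.range fun x : E (ι j) => fun g : G => antiVec (Φ (ι j)) g x)) := by
  obtain ⟨⟨j₀, s₀⟩⟩ := ‹Nonempty (Σ j, E (ι j))›
  haveI : Nonempty (Σ i, E i) := ⟨⟨ι j₀, s₀⟩⟩
  rw [(IsCMTypeWith.sigmaType h).typeRank_eq_finrank_antiSpan_add_one,
    (IsCMTypeWith.sigmaType (E := fun j => E (ι j)) fun j => h (ι j)).typeRank_eq_finrank_antiSpan_add_one,
    finrank_antiSpan_sigmaType_eq_finrank_iSup_span_coeff Φ,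
    finrank_antiSpan_sigmaType_eq_finrank_iSup_span_coeff (E := fun j => E (ι j)) fun j => Φ (ι j)]
  omega

/-- **SUB-FAMILY DOMINATION: `rank Σ = rank Σ_ι ⟺ ∀ i, MC_i ≤ ⨆_j MC_{ι j}`** — `MT(∏_I A_i) → MT(∏_J A_{ι j})`
is an isogeny iff every `X^*(MT(A_i))_ℚ` lies in `X^*(MT(∏_J A_{ι j}))_ℚ`: every member is HODGE-DOMINATED by the
sub-product.  File K3 is the single slot `J = {i₀}`; gen 56 F1 gives the same equality as «every type vector is an
equivariant combination of the kept ones». [cite: Deligne1982HodgeCycles, I.5 (p. 53) and I Ex. 3.7 (c)]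
[cite: Gordon1999HodgeAVSurvey, §3 Theorem (proof), 7.7] -/
theorem typeRank_sigmaType_eq_reindex_iff_forall_span_coeff_le {ρ : G} {Φ : ∀ i, Set (E i)}
    (h : ∀ i, IsCMTypeWith ρ (Φ i)) (ι : J → I) [Nonempty (Σ j, E (ι j))] :
    typeRank G (sigmaType Φ) = typeRank G (sigmaType fun j => Φ (ι j)) ↔
      ∀ i, Submodule.span ℚ (Set.range fun x : E i => fun g : G => antiVec (Φ i) g x) ≤
        ⨆ j, Submodule.span ℚ (Set.range fun x : E (ι j) => fun g : G => antiVec (Φ (ι j)) g x) := by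
  haveI := fun i => finite_span_coeff (G := G) (Φ i)
  have hexc := typeRank_sigmaType_reindex_add_finrank_iSup_eq h ι
  have hle := iSup_span_coeff_reindex_le (G := G) Φ ι
  set C : I → Submodule ℚ (G → ℚ) := fun i =>
    Submodule.span ℚ (Set.range fun x : E i => fun g : G => antiVec (Φ i) g x) with hC
  change (⨆ j, C (ι j)) ≤ ⨆ i, C i at hle
  change _ + Module.finrank ℚ ↥(⨆ i, C i) = _ + Module.finrank ℚ ↥(⨆ j, C (ι j)) at hexc
  change _ ↔ ∀ i, C i ≤ ⨆ j, C (ι j)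
  constructor
  · intro heq i
    have hfin : Module.finrank ℚ ↥(⨆ i, C i) = Module.finrank ℚ ↥(⨆ j, C (ι j)) := by omega
    rw [Submodule.eq_of_le_of_finrank_eq hle hfin.symm]
    exact le_iSup C i
  · intro hall
    have heq : (⨆ j, C (ι j)) = ⨆ i, C i := le_antisymm hle (iSup_le hall)
    rw [heq] at hexc
    omega

/-- `rank Σ = rank Σ_ι ⟺ MC_{range ι} = MC_I` (equality of the character groups).
[cite: Deligne1982HodgeCycles, I.5 (p. 53)] -/
theorem typeRank_sigmaType_eq_reindex_iff_iSup_span_coeff_eq {ρ : G} {Φ : ∀ i, Set (E i)}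
    (h : ∀ i, IsCMTypeWith ρ (Φ i)) (ι : J → I) [Nonempty (Σ j, E (ι j))] :
    typeRank G (sigmaType Φ) = typeRank G (sigmaType fun j => Φ (ι j)) ↔
      (⨆ j, Submodule.span ℚ (Set.range fun x : E (ι j) => fun g : G => antiVec (Φ (ι j)) g x)) =
        ⨆ i, Submodule.span ℚ (Set.range fun x : E i => fun g : G => antiVec (Φ i) g x) := by
  rw [typeRank_sigmaType_eq_reindex_iff_forall_span_coeff_le h ι]
  exact ⟨fun hall => le_antisymm (iSup_span_coeff_reindex_le (G := G) Φ ι) (iSup_le hall),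
    fun heq i => heq ▸ le_iSup (fun i => Submodule.span ℚ (Set.range fun x : E i => fun g : G =>
      antiVec (Φ i) g x)) i⟩

/-- **Reindexing along a SURJECTION changes nothing**: `rank Σ_ι = rank Σ` (repeating factors of a product does not
enlarge its Mumford–Tate group: `MC_{range ι} = MC_I`). [cite: Deligne1982HodgeCycles, I Ex. 3.7 (c)] -/
theorem typeRank_sigmaType_reindex_eq_of_surjective {ρ : G} {Φ : ∀ i, Set (E i)}
    (h : ∀ i, IsCMTypeWith ρ (Φ i)) {ι : J → I} (hι : Function.Surjective ι) [Nonempty (Σ j, E (ι j))] :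
    typeRank G (sigmaType fun j => Φ (ι j)) = typeRank G (sigmaType Φ) := by
  refine ((typeRank_sigmaType_eq_reindex_iff_forall_span_coeff_le h ι).2 fun i => ?_).symm
  obtain ⟨j, rfl⟩ := hι i
  exact le_iSup (fun j => Submodule.span ℚ (Set.range fun x : E (ι j) => fun g : G => antiVec (Φ (ι j)) g x)) j

/-- **NESTED SUB-FAMILIES**: for `κ : J′ → J`, `rank Σ = rank Σ_{ι ∘ κ} ⟺ rank Σ = rank Σ_ι ∧
rank Σ_ι = rank Σ_{ι∘κ}` (`rank Σ_{ι∘κ} ≤ rank Σ_ι ≤ rank Σ`: domination by a deeper sub-product passes through every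
intermediate one). [cite: Gordon1999HodgeAVSurvey, 7.5–7.7] -/
theorem typeRank_sigmaType_eq_reindex_comp_iff {ρ : G} {Φ : ∀ i, Set (E i)} (h : ∀ i, IsCMTypeWith ρ (Φ i))
    (ι : J → I) (κ : J' → J) [Nonempty (Σ j', E (ι (κ j')))] :
    typeRank G (sigmaType Φ) = typeRank G (sigmaType fun j' => Φ (ι (κ j'))) ↔
      typeRank G (sigmaType Φ) = typeRank G (sigmaType fun j => Φ (ι j)) ∧
        typeRank G (sigmaType fun j => Φ (ι j)) = typeRank G (sigmaType fun j' => Φ (ι (κ j'))) := by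
  obtain ⟨⟨j₀', s₀⟩⟩ := ‹Nonempty (Σ j', E (ι (κ j')))›
  haveI : Nonempty (Σ j, E (ι j)) := ⟨⟨κ j₀', s₀⟩⟩
  have h₁ := typeRank_sigmaType_reindex_le h ι
  have h₂ := typeRank_sigmaType_reindex_le (E := fun j => E (ι j)) (fun j => h (ι j)) κ
  change typeRank G (sigmaType fun j' => Φ (ι (κ j'))) ≤ typeRank G (sigmaType fun j => Φ (ι j)) at h₂
  omega

/-! ### §2 Two blocks: the exact defect is the dimension of the common matrix coefficients -/

omit [∀ i, Fintype (E i)] [Fintype I] [Fintype J] [Fintype J'] in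
/-- `MC_{p ∨ q} = MC_p + MC_q`. [cite: Deligne1982HodgeCycles, I.5 (p. 53)] -/
theorem iSup_span_coeff_subtype_eq_sup_of_union (Φ : ∀ i, Set (E i)) (p q r : I → Prop)
    (hr : ∀ i, r i ↔ p i ∨ q i) :
    (⨆ j : {i // r i}, Submodule.span ℚ (Set.range fun x : E j.1 => fun g : G => antiVec (Φ j.1) g x)) =
      (⨆ j : {i // p i}, Submodule.span ℚ (Set.range fun x : E j.1 => fun g : G => antiVec (Φ j.1) g x)) ⊔
        ⨆ j : {i // q i}, Submodule.span ℚ (Set.range fun x : E j.1 => fun g : G => antiVec (Φ j.1) g x) := by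
  set C : I → Submodule ℚ (G → ℚ) := fun i =>
    Submodule.span ℚ (Set.range fun x : E i => fun g : G => antiVec (Φ i) g x) with hC
  change (⨆ j : {i // r i}, C j.1) = (⨆ j : {i // p i}, C j.1) ⊔ ⨆ j : {i // q i}, C j.1
  apply le_antisymm
  · refine iSup_le fun j => ?_
    rcases (hr j.1).1 j.2 with hp | hq
    · exact le_sup_of_le_left (le_iSup (fun j : {i // p i} => C j.1) ⟨j.1, hp⟩)
    · exact le_sup_of_le_right (le_iSup (fun j : {i // q i} => C j.1) ⟨j.1, hq⟩)
  · exact sup_le (iSup_le fun j => le_iSup (fun j : {i // r i} => C j.1) ⟨j.1, (hr j.1).2 (Or.inl j.2)⟩)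
      (iSup_le fun j => le_iSup (fun j : {i // r i} => C j.1) ⟨j.1, (hr j.1).2 (Or.inr j.2)⟩)

omit [Fintype J] [Fintype J'] in
/-- `rank Σ|_p − 1 = dim MC_p` (gen 64 R1 for the sub-family `p`). [cite: Ribet1980, §3 (3.3)]
[cite: Deligne1982HodgeCycles, I.5 (p. 53)] -/
theorem typeRank_sigmaType_subtype_eq_finrank_iSup_add_one {ρ : G} {Φ : ∀ i, Set (E i)}
    (h : ∀ i, IsCMTypeWith ρ (Φ i)) (p : I → Prop) [Nonempty (Σ j : {i // p i}, E j.1)] :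
    typeRank G (sigmaType fun j : {i // p i} => Φ j.1) =
      Module.finrank ℚ
          ↥(⨆ j : {i // p i}, Submodule.span ℚ (Set.range fun x : E j.1 => fun g : G => antiVec (Φ j.1) g x)) +
        1 := by
  rw [(IsCMTypeWith.sigmaType (E := fun j : {i // p i} => E j.1) fun j => h j.1).typeRank_eq_finrank_antiSpan_add_one,
    finrank_antiSpan_sigmaType_eq_finrank_iSup_span_coeff (E := fun j : {i // p i} => E j.1) fun j => Φ j.1]

omit [Fintype J] [Fintype J'] in
/-- **THE EXACT TWO-BLOCK DEFECT: `rank Σ|_p + rank Σ|_q = rank Σ|_{p ∨ q} + 1 + dim(MC_p ∩ MC_q)`**, i.e.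
**`dim Hg(∏_p A_i) + dim Hg(∏_q A_i) − dim Hg(∏_{p ∪ q} A_i) = dim(MC_p ∩ MC_q)`** — the codimension of
`Hg(∏_{p∪q} A_i)` in `Hg(∏_p A_i) × Hg(∏_q A_i)` is the dimension of the space of matrix coefficients common to the
two sub-products (Grassmann in `ℚ^G`; gen 64 R1's pair defect is the case of two single slots).
[cite: Deligne1982HodgeCycles, I.5 (p. 53) and I Ex. 3.7 (c)] [cite: Gordon1999HodgeAVSurvey, §3 Theorem (proof),
7.5–7.7] [cite: Ribet1980, §3 (3.3)] -/
theorem typeRank_sigmaType_add_typeRank_sigmaType_eq_of_union {ρ : G} {Φ : ∀ i, Set (E i)}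
    (h : ∀ i, IsCMTypeWith ρ (Φ i)) (p q r : I → Prop) (hr : ∀ i, r i ↔ p i ∨ q i)
    [Nonempty (Σ j : {i // p i}, E j.1)] [Nonempty (Σ j : {i // q i}, E j.1)] :
    typeRank G (sigmaType fun j : {i // p i} => Φ j.1) + typeRank G (sigmaType fun j : {i // q i} => Φ j.1) =
      typeRank G (sigmaType fun j : {i // r i} => Φ j.1) + 1 +
        Module.finrank ℚ
          ↥((⨆ j : {i // p i}, Submodule.span ℚ (Set.range fun x : E j.1 => fun g : G => antiVec (Φ j.1) g x)) ⊓
            ⨆ j : {i // q i}, Submodule.span ℚ (Set.range fun x : E j.1 => fun g : G => antiVec (Φ j.1) g x)) := by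
  obtain ⟨⟨⟨i₁, hi₁⟩, s₁⟩⟩ := ‹Nonempty (Σ j : {i // p i}, E j.1)›
  haveI : Nonempty (Σ j : {i // r i}, E j.1) := ⟨⟨⟨i₁, (hr i₁).2 (Or.inl hi₁)⟩, s₁⟩⟩
  haveI := fun i => finite_span_coeff (G := G) (Φ i)
  rw [typeRank_sigmaType_subtype_eq_finrank_iSup_add_one h p, typeRank_sigmaType_subtype_eq_finrank_iSup_add_one h q,
    typeRank_sigmaType_subtype_eq_finrank_iSup_add_one h r, iSup_span_coeff_subtype_eq_sup_of_union Φ p q r hr]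
  set C : I → Submodule ℚ (G → ℚ) := fun i =>
    Submodule.span ℚ (Set.range fun x : E i => fun g : G => antiVec (Φ i) g x) with hC
  change Module.finrank ℚ ↥(⨆ j : {i // p i}, C j.1) + 1 + (Module.finrank ℚ ↥(⨆ j : {i // q i}, C j.1) + 1) =
    Module.finrank ℚ ↥((⨆ j : {i // p i}, C j.1) ⊔ ⨆ j : {i // q i}, C j.1) + 1 + 1 +
      Module.finrank ℚ ↥((⨆ j : {i // p i}, C j.1) ⊓ ⨆ j : {i // q i}, C j.1)
  haveI : ∀ i, Module.Finite ℚ ↥(C i) := fun i => finite_span_coeff (G := G) (Φ i)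
  have hg := Submodule.finrank_sup_add_finrank_inf_eq (⨆ j : {i // p i}, C j.1) (⨆ j : {i // q i}, C j.1)
  omega

omit [Fintype J] [Fintype J'] in
/-- **Two blocks are additive — `Hg(∏_{p∪q} A_i) = Hg(∏_p A_i) × Hg(∏_q A_i)` — iff `MC_p ∩ MC_q = 0`.**
[cite: Gordon1999HodgeAVSurvey, §3 Theorem and 7.5–7.7] [cite: Deligne1982HodgeCycles, I.5 (p. 53)] -/
theorem typeRank_sigmaType_add_typeRank_sigmaType_eq_add_one_iff_of_union {ρ : G} {Φ : ∀ i, Set (E i)}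
    (h : ∀ i, IsCMTypeWith ρ (Φ i)) (p q r : I → Prop) (hr : ∀ i, r i ↔ p i ∨ q i)
    [Nonempty (Σ j : {i // p i}, E j.1)] [Nonempty (Σ j : {i // q i}, E j.1)] :
    typeRank G (sigmaType fun j : {i // p i} => Φ j.1) + typeRank G (sigmaType fun j : {i // q i} => Φ j.1) =
        typeRank G (sigmaType fun j : {i // r i} => Φ j.1) + 1 ↔
      (⨆ j : {i // p i}, Submodule.span ℚ (Set.range fun x : E j.1 => fun g : G => antiVec (Φ j.1) g x)) ⊓
          (⨆ j : {i // q i}, Submodule.span ℚ (Set.range fun x : E j.1 => fun g : G => antiVec (Φ j.1) g x)) =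
        ⊥ := by
  have hblock := typeRank_sigmaType_add_typeRank_sigmaType_eq_of_union h p q r hr
  set C : I → Submodule ℚ (G → ℚ) := fun i =>
    Submodule.span ℚ (Set.range fun x : E i => fun g : G => antiVec (Φ i) g x) with hC
  change _ = _ + Module.finrank ℚ ↥((⨆ j : {i // p i}, C j.1) ⊓ ⨆ j : {i // q i}, C j.1) at hblock
  change _ ↔ (⨆ j : {i // p i}, C j.1) ⊓ (⨆ j : {i // q i}, C j.1) = ⊥
  haveI : ∀ i, Module.Finite ℚ ↥(C i) := fun i => finite_span_coeff (G := G) (Φ i)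
  haveI : Module.Finite ℚ ↥(⨆ j : {i // p i}, C j.1) := Submodule.finite_iSup _
  haveI : Module.Finite ℚ ↥((⨆ j : {i // p i}, C j.1) ⊓ ⨆ j : {i // q i}, C j.1) :=
    Submodule.finiteDimensional_inf_left _ _
  rw [← Submodule.finrank_eq_zero]
  omega

omit [Fintype J] [Fintype J'] in
/-- **DOMINATION OF ONE BLOCK BY ANOTHER: `rank Σ|_{p ∨ q} = rank Σ|_p ⟺ MC_q ≤ MC_p`** (`MT(∏_{p∪q} A_i) →
MT(∏_p A_i)` is an isogeny iff the character group of the `q`-block lies in that of the `p`-block).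
[cite: Deligne1982HodgeCycles, I.5 (p. 53)] [cite: Gordon1999HodgeAVSurvey, §3 Theorem (proof), 7.7] -/
theorem typeRank_sigmaType_eq_iff_iSup_span_coeff_le_of_union {ρ : G} {Φ : ∀ i, Set (E i)}
    (h : ∀ i, IsCMTypeWith ρ (Φ i)) (p q r : I → Prop) (hr : ∀ i, r i ↔ p i ∨ q i)
    [Nonempty (Σ j : {i // p i}, E j.1)] :
    typeRank G (sigmaType fun j : {i // r i} => Φ j.1) = typeRank G (sigmaType fun j : {i // p i} => Φ j.1) ↔
      (⨆ j : {i // q i}, Submodule.span ℚ (Set.range fun x : E j.1 => fun g : G => antiVec (Φ j.1) g x)) ≤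
        ⨆ j : {i // p i}, Submodule.span ℚ (Set.range fun x : E j.1 => fun g : G => antiVec (Φ j.1) g x) := by
  -- the `p`-block is the reindexing of the `r`-family along the inclusion `{p} ↪ {r}`
  let κ : {i // p i} → {i // r i} := fun j => ⟨j.1, (hr j.1).2 (Or.inl j.2)⟩
  obtain ⟨⟨j₁, s₁⟩⟩ := ‹Nonempty (Σ j : {i // p i}, E j.1)›
  haveI : Nonempty (Σ j : {i // p i}, E (κ j).1) := ⟨⟨j₁, s₁⟩⟩
  have key := typeRank_sigmaType_eq_reindex_iff_forall_span_coeff_le (E := fun j : {i // r i} => E j.1)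
    (Φ := fun j : {i // r i} => Φ j.1) (fun j => h j.1) κ
  change typeRank G (sigmaType fun j : {i // r i} => Φ j.1) = typeRank G (sigmaType fun j : {i // p i} => Φ j.1) ↔
    ∀ j : {i // r i}, Submodule.span ℚ (Set.range fun x : E j.1 => fun g : G => antiVec (Φ j.1) g x) ≤
      ⨆ j : {i // p i}, Submodule.span ℚ (Set.range fun x : E j.1 => fun g : G => antiVec (Φ j.1) g x) at key
  rw [key]
  set C : I → Submodule ℚ (G → ℚ) := fun i =>
    Submodule.span ℚ (Set.range fun x : E i => fun g : G => antiVec (Φ i) g x) with hC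
  change (∀ j : {i // r i}, C j.1 ≤ ⨆ j : {i // p i}, C j.1) ↔ (⨆ j : {i // q i}, C j.1) ≤ ⨆ j : {i // p i}, C j.1
  constructor
  · intro hall
    exact iSup_le fun j => hall ⟨j.1, (hr j.1).2 (Or.inr j.2)⟩
  · intro hle j
    rcases (hr j.1).1 j.2 with hp | hq
    · exact le_iSup (fun j : {i // p i} => C j.1) ⟨j.1, hp⟩
    · exact (le_iSup (fun j : {i // q i} => C j.1) ⟨j.1, hq⟩).trans hle

/-! ### §3 One more slot -/

omit [∀ i, Fintype (E i)] [Fintype I] [Fintype J] [Fintype J'] in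
/-- `MC_{(· = i₀)} = MC_{i₀}` (a single-slot block). [cite: Deligne1982HodgeCycles, I.5 (p. 53)] -/
theorem iSup_span_coeff_subtype_eq_of_singleton (Φ : ∀ i, Set (E i)) (i₀ : I) :
    (⨆ j : {i // i = i₀}, Submodule.span ℚ (Set.range fun x : E j.1 => fun g : G => antiVec (Φ j.1) g x)) =
      Submodule.span ℚ (Set.range fun x : E i₀ => fun g : G => antiVec (Φ i₀) g x) := by
  set C : I → Submodule ℚ (G → ℚ) := fun i =>
    Submodule.span ℚ (Set.range fun x : E i => fun g : G => antiVec (Φ i) g x) with hC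
  change (⨆ j : {i // i = i₀}, C j.1) = C i₀
  apply le_antisymm
  · refine iSup_le fun j => ?_
    obtain ⟨i, rfl⟩ := j
    exact le_rfl
  · exact le_iSup (fun j : {i // i = i₀} => C j.1) ⟨i₀, rfl⟩

omit [Fintype J] [Fintype J'] in
/-- `rank Σ|_{(· = i₀)} = rank Φ_{i₀}` (a one-member family). [cite: Deligne1982HodgeCycles, I Ex. 3.7 (c)] -/
theorem typeRank_sigmaType_subtype_eq_of_singleton {ρ : G} {Φ : ∀ i, Set (E i)} (h : ∀ i, IsCMTypeWith ρ (Φ i))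
    (i₀ : I) [Nonempty (E i₀)] :
    typeRank G (sigmaType fun j : {i // i = i₀} => Φ j.1) = typeRank G (Φ i₀) := by
  haveI : Nonempty (Σ j : {i // i = i₀}, E j.1) := ⟨⟨⟨i₀, rfl⟩, Classical.arbitrary (E i₀)⟩⟩
  rw [typeRank_sigmaType_subtype_eq_finrank_iSup_add_one h (· = i₀), iSup_span_coeff_subtype_eq_of_singleton Φ i₀,
    (h i₀).typeRank_eq_finrank_antiSpan_add_one, finrank_antiSpan_eq_finrank_span_coeff]

omit [Fintype J] [Fintype J'] in
/-- **ONE MORE SLOT: `rank Σ|_{p ∪ {i₀}} + 1 + dim(MC_p ∩ MC_{i₀}) = rank Σ|_p + rank Φ_{i₀}`**, i.e. the INCREMENT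
`dim Hg(∏_{p∪{i₀}} A_i) − dim Hg(∏_p A_i)` is `dim Hg(A_{i₀}) − dim(MC_p ∩ MC_{i₀})` — `A_{i₀}` adds its full Hodge
group exactly when none of its matrix coefficients is already a coefficient of the `p`-block (file K3's pair excess is
`p = {i₁}`). [cite: Deligne1982HodgeCycles, I.5 (p. 53)] [cite: Gordon1999HodgeAVSurvey, §3 Theorem (proof), 7.5–7.7,
9.1] -/
theorem typeRank_sigmaType_add_one_add_finrank_inf_eq_of_insert {ρ : G} {Φ : ∀ i, Set (E i)}
    (h : ∀ i, IsCMTypeWith ρ (Φ i)) (p q : I → Prop) {i₀ : I} (hq : ∀ i, q i ↔ p i ∨ i = i₀)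
    [Nonempty (Σ j : {i // p i}, E j.1)] [Nonempty (E i₀)] :
    typeRank G (sigmaType fun j : {i // q i} => Φ j.1) + 1 +
        Module.finrank ℚ
          ↥((⨆ j : {i // p i}, Submodule.span ℚ (Set.range fun x : E j.1 => fun g : G => antiVec (Φ j.1) g x)) ⊓
            Submodule.span ℚ (Set.range fun x : E i₀ => fun g : G => antiVec (Φ i₀) g x)) =
      typeRank G (sigmaType fun j : {i // p i} => Φ j.1) + typeRank G (Φ i₀) := by
  haveI : Nonempty (Σ j : {i // i = i₀}, E j.1) := ⟨⟨⟨i₀, rfl⟩, Classical.arbitrary (E i₀)⟩⟩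
  have hblock := typeRank_sigmaType_add_typeRank_sigmaType_eq_of_union h p (· = i₀) q hq
  rw [typeRank_sigmaType_subtype_eq_of_singleton h i₀, iSup_span_coeff_subtype_eq_of_singleton Φ i₀] at hblock
  omega

omit [Fintype J] [Fintype J'] in
/-- **`rank Σ|_{p ∪ {i₀}} = rank Σ|_p ⟺ MC_{i₀} ≤ MC_p`**: the new factor adds NOTHING to the Mumford–Tate group iff
its character group already lies in that of the `p`-block — `A_{i₀}` is HODGE-DOMINATED by `∏_p A_i` (gen 56 F7 §2:
iff `u_{i₀}` is an equivariant combination of the kept type vectors). [cite: Deligne1982HodgeCycles, I.5 (p. 53)]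
[cite: Gordon1999HodgeAVSurvey, §3 Theorem (proof), 7.7] -/
theorem typeRank_sigmaType_eq_iff_span_coeff_le_of_insert {ρ : G} {Φ : ∀ i, Set (E i)}
    (h : ∀ i, IsCMTypeWith ρ (Φ i)) (p q : I → Prop) {i₀ : I} (hq : ∀ i, q i ↔ p i ∨ i = i₀)
    [Nonempty (Σ j : {i // p i}, E j.1)] :
    typeRank G (sigmaType fun j : {i // q i} => Φ j.1) = typeRank G (sigmaType fun j : {i // p i} => Φ j.1) ↔
      Submodule.span ℚ (Set.range fun x : E i₀ => fun g : G => antiVec (Φ i₀) g x) ≤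
        ⨆ j : {i // p i}, Submodule.span ℚ (Set.range fun x : E j.1 => fun g : G => antiVec (Φ j.1) g x) := by
  rw [typeRank_sigmaType_eq_iff_iSup_span_coeff_le_of_union h p (· = i₀) q hq,
    iSup_span_coeff_subtype_eq_of_singleton Φ i₀]

omit [Fintype J] [Fintype J'] in
/-- **THE WHOLE FAMILY VERSUS ALL BUT ONE: `rank Σ + 1 + dim(MC_{≠ i₀} ∩ MC_{i₀}) = rank Σ|_{≠ i₀} + rank Φ_{i₀}`** —
the last factor adds `dim Hg(A_{i₀}) − dim(MC_{≠i₀} ∩ MC_{i₀})` to the Hodge group of the product of all the others.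
[cite: Deligne1982HodgeCycles, I.5 (p. 53)] [cite: Gordon1999HodgeAVSurvey, §3 Theorem (proof), 7.5–7.7, 9.1] -/
theorem typeRank_sigmaType_add_one_add_finrank_inf_eq_of_erase {ρ : G} {Φ : ∀ i, Set (E i)}
    (h : ∀ i, IsCMTypeWith ρ (Φ i)) (i₀ : I) [Nonempty (Σ j : {i // i ≠ i₀}, E j.1)] [Nonempty (E i₀)] :
    typeRank G (sigmaType Φ) + 1 +
        Module.finrank ℚ
          ↥((⨆ j : {i // i ≠ i₀}, Submodule.span ℚ (Set.range fun x : E j.1 => fun g : G => antiVec (Φ j.1) g x)) ⊓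
            Submodule.span ℚ (Set.range fun x : E i₀ => fun g : G => antiVec (Φ i₀) g x)) =
      typeRank G (sigmaType fun j : {i // i ≠ i₀} => Φ j.1) + typeRank G (Φ i₀) := by
  have hins := typeRank_sigmaType_add_one_add_finrank_inf_eq_of_insert h (· ≠ i₀) (fun _ => True) (i₀ := i₀)
    (fun i => by by_cases hi : i = i₀ <;> simp [hi])
  haveI : Nonempty (Σ j : {i // True}, E (Subtype.val j)) := ⟨⟨⟨i₀, trivial⟩, Classical.arbitrary (E i₀)⟩⟩
  have hsurj := typeRank_sigmaType_reindex_eq_of_surjective h (ι := (Subtype.val : {i // True} → I))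
    (fun i => ⟨⟨i, trivial⟩, rfl⟩)
  change typeRank G (sigmaType fun j : {i // True} => Φ j.1) = typeRank G (sigmaType Φ) at hsurj
  omega

omit [Fintype J] [Fintype J'] in
/-- **`rank Σ = rank Σ|_{≠ i₀} ⟺ MC_{i₀} ≤ MC_{≠ i₀}`**: `A_{i₀}` is Hodge-dominated by the product of all the other
members (`MT(∏_i A_i) → MT(∏_{i ≠ i₀} A_i)` an isogeny). [cite: Deligne1982HodgeCycles, I.5 (p. 53)]
[cite: Gordon1999HodgeAVSurvey, §3 Theorem (proof), 7.7] -/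
theorem typeRank_sigmaType_eq_iff_span_coeff_le_of_erase {ρ : G} {Φ : ∀ i, Set (E i)}
    (h : ∀ i, IsCMTypeWith ρ (Φ i)) (i₀ : I) [Nonempty (Σ j : {i // i ≠ i₀}, E j.1)] :
    typeRank G (sigmaType Φ) = typeRank G (sigmaType fun j : {i // i ≠ i₀} => Φ j.1) ↔
      Submodule.span ℚ (Set.range fun x : E i₀ => fun g : G => antiVec (Φ i₀) g x) ≤
        ⨆ j : {i // i ≠ i₀}, Submodule.span ℚ (Set.range fun x : E j.1 => fun g : G => antiVec (Φ j.1) g x) := by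
  have hins := typeRank_sigmaType_eq_iff_span_coeff_le_of_insert h (· ≠ i₀) (fun _ => True) (i₀ := i₀)
    (fun i => by by_cases hi : i = i₀ <;> simp [hi])
  obtain ⟨⟨⟨i₁, _⟩, s₁⟩⟩ := ‹Nonempty (Σ j : {i // i ≠ i₀}, E j.1)›
  haveI : Nonempty (Σ j : {i // True}, E (Subtype.val j)) := ⟨⟨⟨i₁, trivial⟩, s₁⟩⟩
  have hsurj := typeRank_sigmaType_reindex_eq_of_surjective h (ι := (Subtype.val : {i // True} → I))
    (fun i => ⟨⟨i, trivial⟩, rfl⟩)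
  change typeRank G (sigmaType fun j : {i // True} => Φ j.1) = typeRank G (sigmaType Φ) at hsurj
  rw [← hsurj, hins]

end Summit.HodgeConjecture.CorCM.IrrOdd

end
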